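import Summits.CriticalPhenomena.PercolationContinuityZ3.Theses.PercFiniteBoxLRO
import Summits.CriticalPhenomena.PercolationContinuityZ3.Theorems.PercFiniteBoxLROLinearScaleLROOfThetaShellFew27
import Summits.CriticalPhenomena.PercolationContinuityZ3.Theorems.PercFiniteBoxLROLinearScaleLROOfThetaEquivalences

/-!
# `Lines/birth.lean` — skeleton for crux `PercFiniteBoxLRO.LinearScaleLROOfTheta`
(item stmt-CriticalPhenomena-0855 · route route-CriticalPhenomena-PercFiniteBoxLRO ·
sub-problem `PercolationContinuityZ3` · birth by planner-skel-stmt-CriticalPhenomena-0855-0,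
reshapes 1–2 by lead 0, reshapes 3 by lead c1, reshapes 4–5 by lead c2, 2026-08-17)

**Crux.** `LinearScaleLROOfTheta` = Cerf's "missing ingredient" `X_D` (arXiv:1306.3105, p. 4): for
bond percolation on `ℤ³`, `∀ p, 0 < θ(p) → ∃ ρ > 0, ∃ K, ∀ n ≥ 1, ∀ x y ∈ Λ_n,
ρ ≤ P_p(x ↔ y inside Λ_{Kn})`.

**History (all LANDED).**  Lead 0: `stub_supercritBadPairDecay` (p147500), `stub_fkgChaining`
(p148697), reduction (p150787: the crux is EQUIVALENT to its critical one-site floor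
`θ(p_c) > 0 ⟹ ∃ ρ₀ K, ∀ n ≥ 1, ∃ x ∈ ∂ⁱⁿΛ_n, P_{p_c}(0 ↔ x in Λ_{Kn}) ≥ ρ₀`).  Lead c1: equivalences
(p153556) and the NON-EQUIVALENT thinness entrances — shell uniqueness (p154756, p155648), fewer
than 8 crossers (p157450, p157511), fewer than 27 crossers at log-syndetic scales (p170594, via the 27
grid points `{0,d,2d}³`, Cerf's reflection step `bad_half`, Harris–FKG, independence of disjoint
shells).  Lead c2, reshape 4: the registered stub made θ-conditional (it is only consumed under
`0 < θ(p_c)`).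

**Reshape 5 (lead c2): the threshold 27 is removed — NON-PROLIFERATION PROPER.**  The reflection
step generalises from face reflections to ALL 48 signed permutations `A` of `ℤ³`: if `0 ↔ v` inside
`Λ_B` has probability `σ`, then (isometry `x ↦ Ax + (v - Av)` fixing `v`, Harris–FKG) `0 ↔ v - Av`
inside `Λ_{B+‖v-Av‖}` has probability `≥ σ²` (`stub_signedPermChain`, iterated along a word).  The
semigroup generated by the maps `v ↦ v - Av` contains length-2 words acting as TRANSVECTIONS on
`(1,1,0)` (e.g. `W(1,1,0) = (1,3,2)`, `W(0,2,2) = (0,2,2)`, so `Wᵇ(1,1,0) = (1, 1+2b, 2b)` has sup-norm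
`2b+1`; a sibling word gives all even sup-norms), hence EVERY axis vector `k e₀`, `1 ≤ |k| ≤ N`, is
taken by a word of length `≤ N! + 1` to the sphere of radius `N!` (`stub_wordToSphere`, pure
arithmetic on `ℤ³`).  Consequently, if the whole sphere `∂ⁱⁿΛ_n` is bad (floor fails at scale `n`),
the `N` collinear grid points `i⌊n/N!⌋e₀`, `i < N`, are pairwise bad, all percolate and are pairwise
not joined inside `Λ_{(K-2)n}` with probability `≥ θ^N/2`, and split every good shell into `≥ N`
crossing clusters (`stub_floorOfShellBounded`, the generalisation of p170594 to arbitrary `N`).  So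
the open hypothesis loses its magic number: `stub_jumpShellBoundedSyndetic` = "IF `θ(p_c) > 0`, then
for SOME bound `N`, some aspect `l ≥ 2`, `L ≥ 1`, `δ > 0`: every window `[a, La]` of scales (`a`
large) contains a `k` with `P_{p_c}`(fewer than `N` pairwise shell-distinct crossers of
`Λ_{l(k+1)} ∖ Λ_k`) `≥ δ`" — positive-probability BOUNDEDNESS of the shell-crosser count at a
log-syndetic set of scales, i.e. non-proliferation of spanning clusters in the sense of Aizenman 1997 /
BCKS 1999 (the family of `PercNonProliferation`'s crux 4444 and of its load-bearing stub S1), believed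
in `d = 3` by hyperscaling, false for `d > 6`, OPEN.  (An earlier note of c2 claiming "27 is the
ceiling of the method" was an artifact of a dyadic normalisation and is WRONG: with all radii
`n/c`, `c ∈ ℕ`, available, collinear grids of any size work.)

Layout: §0 name-keyed statements · §1 the registered stubs (the only `sorry`s) · §2 composition
(`LinearScaleLROOfTheta_of_stubs`, concludes the crux BY NAME) · §3 consistency / record.
-/

namespace Summit.CriticalPhenomena.PercolationContinuityZ3.Cruxes.LinearScaleLROOfTheta.Birth

open Literature.Probability.Percolation Literature.Probability.LatticeModels
open MeasureTheory

/-! ## §0 Name-keyed stub statements -/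

namespace Sig

/-- Name-keyed statement of `stub_wordToSphere` (reshape 5, lead c2; PROVABLE, pure arithmetic on `ℤ³`):
every nonzero axis vector `k e₀` with `|k| ≤ N` is taken to the sphere `‖·‖∞ = N!` by a word of length
`≤ N! + 1` in the maps `v ↦ v - Av`, `A` a signed permutation, staying inside `Λ_{N!}`. [stub statement] -/
def stub_wordToSphere : Prop :=
  ∀ (N : ℕ) (k : ℤ), 1 ≤ N → k ≠ 0 → |k| ≤ N →
    ∃ (r : ℕ) (v : ℕ → Site 3) (π : ℕ → Equiv.Perm (Fin 3)) (ε : ℕ → Fin 3 → ℤˣ),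
      r ≤ Nat.factorial N + 1 ∧
      v 0 = Pi.single 0 k ∧
      (∀ j, j < r → v (j + 1) = v j - Site.signedPerm (π j) (ε j) (v j)) ∧
      (∀ j, j ≤ r → v j ∈ box 3 (Nat.factorial N)) ∧
      v r ∈ innerBoundary (zdGraph 3) (box 3 (Nat.factorial N))

/-- Name-keyed statement of `stub_signedPermChain` (reshape 5, lead c2; PROVABLE, Cerf's reflection step for
all signed permutations, iterated): along a word `v_{j+1} = v_j - A_j v_j` with all `v_j ∈ Λ_k`,
`P_p(0 ↔ v_0 in Λ_B)^{2^r} ≤ P_p(0 ↔ v_r in Λ_{B + r k})`. [stub statement] -/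
def stub_signedPermChain : Prop :=
  ∀ (p : unitInterval) (B k r : ℕ) (v : ℕ → Site 3) (π : ℕ → Equiv.Perm (Fin 3)) (ε : ℕ → Fin 3 → ℤˣ),
    (∀ j, j < r → v (j + 1) = v j - Site.signedPerm (π j) (ε j) (v j)) →
    (∀ j, j ≤ r → v j ∈ box 3 k) →
    (bondPercolation (zdGraph 3) p).real (openConnIn (↑(box 3 B) : Set (Site 3)) (0 : Site 3) (v 0)) ^ (2 ^ r) ≤
      (bondPercolation (zdGraph 3) p).real
        (openConnIn (↑(box 3 (B + r * k)) : Set (Site 3)) (0 : Site 3) (v r))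

/-- Name-keyed statement of `stub_floorOfShellBounded` (reshape 5, lead c2; PROVABLE — the generalisation of
`criticalFloor_of_shellFew27_syndetic`, p170594, from 27 to an arbitrary bound `N`, given the two tools
above): positive-probability boundedness (by `N`) of the shell-crosser count at a log-syndetic set of scales,
at `p_c(ℤ³)`, gives the critical one-site floor. [stub statement] -/
def stub_floorOfShellBounded : Prop :=
  stub_wordToSphere → stub_signedPermChain →
  ∀ N : ℕ, (∃ l : ℕ, 2 ≤ l ∧ ∃ L : ℕ, 1 ≤ L ∧ ∃ δ : ℝ, 0 < δ ∧ ∃ a₀ : ℕ, ∀ a : ℕ, a₀ ≤ a →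
      ∃ k : ℕ, a ≤ k ∧ k ≤ L * a ∧
      δ ≤ (bondPercolation (zdGraph 3) (criticalProbI 3)).real {ω : BondConfig (Site 3) |
        ¬ ∃ x : Fin N → Site 3, (∀ i, x i ∈ innerBoundary (zdGraph 3) (box 3 (k + 1))) ∧
          (∀ i, ∃ b ∈ innerBoundary (zdGraph 3) (box 3 (l * (k + 1))),
            ω ∈ openConnIn (↑(box 3 (l * (k + 1)) \ box 3 k) : Set (Site 3)) (x i) b) ∧
          ∀ i j, i ≠ j → ω ∉ openConnIn (↑(box 3 (l * (k + 1)) \ box 3 k) : Set (Site 3)) (x i) (x j)}) →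
    0 < theta (zdGraph 3) (0 : Site 3) (criticalProbI 3) →
    ∃ ρ₀ : ℝ, 0 < ρ₀ ∧ ∃ K : ℕ, 1 ≤ K ∧ ∀ n : ℕ, 1 ≤ n →
      ∃ x ∈ innerBoundary (zdGraph 3) (box 3 n),
        ρ₀ ≤ (bondPercolation (zdGraph 3) (criticalProbI 3)).real
          (openConnIn (↑(box 3 (K * n)) : Set (Site 3)) (0 : Site 3) x)

/-- Name-keyed statement of `stub_jumpShellBoundedSyndetic` (reshape 5, lead c2, THE OPEN registered stub —
NON-PROLIFERATION at a percolating `p_c(ℤ³)`): IF `θ(p_c) > 0`, then for some bound `N`, some aspect ratio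
`l ≥ 2` and `L ≥ 1`, every window of scales `[a, La]` (`a` large) contains a `k` at which, with
`P_{p_c}`-probability `≥ δ > 0`, the shell `Λ_{l(k+1)} ∖ Λ_k` has fewer than `N` pairwise shell-distinct
crossing clusters. [stub statement; OPEN in the jump world, vacuous if `θ(p_c) = 0`] -/
def stub_jumpShellBoundedSyndetic : Prop :=
  0 < theta (zdGraph 3) (0 : Site 3) (criticalProbI 3) →
  ∃ N : ℕ, ∃ l : ℕ, 2 ≤ l ∧ ∃ L : ℕ, 1 ≤ L ∧ ∃ δ : ℝ, 0 < δ ∧ ∃ a₀ : ℕ, ∀ a : ℕ, a₀ ≤ a →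
    ∃ k : ℕ, a ≤ k ∧ k ≤ L * a ∧
    δ ≤ (bondPercolation (zdGraph 3) (criticalProbI 3)).real {ω : BondConfig (Site 3) |
      ¬ ∃ x : Fin N → Site 3, (∀ i, x i ∈ innerBoundary (zdGraph 3) (box 3 (k + 1))) ∧
        (∀ i, ∃ b ∈ innerBoundary (zdGraph 3) (box 3 (l * (k + 1))),
          ω ∈ openConnIn (↑(box 3 (l * (k + 1)) \ box 3 k) : Set (Site 3)) (x i) b) ∧
        ∀ i j, i ≠ j → ω ∉ openConnIn (↑(box 3 (l * (k + 1)) \ box 3 k) : Set (Site 3)) (x i) (x j)}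

/-- Name-keyed statement of the θ-conditional 27-form of reshape 4 (kept for the record; it is the case
`N = 27` of `stub_jumpShellBoundedSyndetic`, hence implies it). -/
def stub_jumpShellFew27Syndetic : Prop :=
  0 < theta (zdGraph 3) (0 : Site 3) (criticalProbI 3) →
  ∃ l : ℕ, 2 ≤ l ∧ ∃ L : ℕ, 1 ≤ L ∧ ∃ δ : ℝ, 0 < δ ∧ ∃ a₀ : ℕ, ∀ a : ℕ, a₀ ≤ a →
    ∃ k : ℕ, a ≤ k ∧ k ≤ L * a ∧
    δ ≤ (bondPercolation (zdGraph 3) (criticalProbI 3)).real {ω : BondConfig (Site 3) |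
      ¬ ∃ x : Fin 27 → Site 3, (∀ i, x i ∈ innerBoundary (zdGraph 3) (box 3 (k + 1))) ∧
        (∀ i, ∃ b ∈ innerBoundary (zdGraph 3) (box 3 (l * (k + 1))),
          ω ∈ openConnIn (↑(box 3 (l * (k + 1)) \ box 3 k) : Set (Site 3)) (x i) b) ∧
        ∀ i j, i ≠ j → ω ∉ openConnIn (↑(box 3 (l * (k + 1)) \ box 3 k) : Set (Site 3)) (x i) (x j)}

/-- Name-keyed statement of the crux-EQUIVALENT entrance `stub_critBoundaryGluing` (reshape 2, lead 0; kept for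
the record): the critical one-site floor. -/
def stub_critBoundaryGluing : Prop :=
  0 < theta (zdGraph 3) (0 : Site 3) (criticalProbI 3) →
    ∃ ρ₀ : ℝ, 0 < ρ₀ ∧ ∃ K : ℕ, 1 ≤ K ∧ ∀ n : ℕ, 1 ≤ n →
      ∃ x ∈ innerBoundary (zdGraph 3) (box 3 n),
        ρ₀ ≤ (bondPercolation (zdGraph 3) (criticalProbI 3)).real
          (openConnIn (↑(box 3 (K * n)) : Set (Site 3)) (0 : Site 3) x)

end Sig

/-! ## §1 The registered stubs (the only `sorry`s of the file) -/

/-- **Stub (PROVABLE, arithmetic on `ℤ³`) — words to the sphere.**  For `N ≥ 1` and `0 < |k| ≤ N` there is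
a word `A_0, …, A_{r-1}` of signed permutations of `ℤ³` (`(A v)_i = ε_i v_{π⁻¹ i}`, `Site.signedPerm π ε`),
`r ≤ N! + 1`, whose iteration `v_0 = k e₀`, `v_{j+1} = v_j - A_j v_j` stays in `Λ_{N!}` and ends ON the
sphere `∂ⁱⁿΛ_{N!}`.  Recipe: `A_0 = (swap 0 1, signs (-1,-1,+1))` gives `v_1 = (k,k,0)`; with
`c := N!/|k|`: if `c = 2b+1`, apply `b` times the length-2 word `[(π⁻¹ = (1,2,0), ε = (-1,1,-1)),
(π⁻¹ = (2,0,1), ε = (1,-1,-1))]`, which maps `(1,1+2t,2t) ↦ (1,3+2t,2+2t)`; if `c = 2b` (`b ≥ 1`), apply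
`b` times `[(π⁻¹ = (1,2,0), ε = (1,1,1)), (π⁻¹ = (2,0,1), ε = (-1,-1,1))]`, which maps
`(1-2t,1,-2t) ↦ (-1-2t,1,-2-2t)`; the final sup-norm is `|k| c = N!`.  Size S/M. -/
theorem stub_wordToSphere :
    ∀ (N : ℕ) (k : ℤ), 1 ≤ N → k ≠ 0 → |k| ≤ N →
      ∃ (r : ℕ) (v : ℕ → Site 3) (π : ℕ → Equiv.Perm (Fin 3)) (ε : ℕ → Fin 3 → ℤˣ),
        r ≤ Nat.factorial N + 1 ∧
        v 0 = Pi.single 0 k ∧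
        (∀ j, j < r → v (j + 1) = v j - Site.signedPerm (π j) (ε j) (v j)) ∧
        (∀ j, j ≤ r → v j ∈ box 3 (Nat.factorial N)) ∧
        v r ∈ innerBoundary (zdGraph 3) (box 3 (Nat.factorial N)) := by
  sorry

/-- **Stub (PROVABLE) — Cerf's reflection step for every signed permutation, iterated along a word.**
For bond percolation on `ℤ³` at any `p`: if `v_{j+1} = v_j - A_j v_j` (`A_j` signed permutations) and all
`v_j ∈ Λ_k`, then `P_p(0 ↔ v_0 in Λ_B)^{2^r} ≤ P_p(0 ↔ v_r in Λ_{B + r k})`.  One step: the lattice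
isometry `x ↦ A_j x + v_{j+1}` fixes `v_j`, maps `0 ↦ v_{j+1}` and `Λ_B ↦ Λ_B + v_{j+1} ⊆ Λ_{B+k}`
(`AKN.real_bconn_iso` with `(zdSignedPermIso π ε).trans (zdShiftIso v_{j+1})`, `signedPerm_image_box`),
so `{0 ↔ v_j in Λ_B}` and its image `{v_{j+1} ↔ v_j in Λ_B + v_{j+1}}` have the same probability and glue
by Harris–FKG inside `Λ_{B+k}` (`AKN.real_bconn_mul_le`; cf. `ShellUniq.sq_real_bconn_le_reflect`, the
face-reflection case); then induct on `r`.  Size M. [cite: Cerf2015, Lemma 6.1 (proof)] -/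
theorem stub_signedPermChain :
    ∀ (p : unitInterval) (B k r : ℕ) (v : ℕ → Site 3) (π : ℕ → Equiv.Perm (Fin 3)) (ε : ℕ → Fin 3 → ℤˣ),
      (∀ j, j < r → v (j + 1) = v j - Site.signedPerm (π j) (ε j) (v j)) →
      (∀ j, j ≤ r → v j ∈ box 3 k) →
      (bondPercolation (zdGraph 3) p).real (openConnIn (↑(box 3 B) : Set (Site 3)) (0 : Site 3) (v 0)) ^ (2 ^ r) ≤
        (bondPercolation (zdGraph 3) p).real
          (openConnIn (↑(box 3 (B + r * k)) : Set (Site 3)) (0 : Site 3) (v r)) := by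
  sorry

/-- **Stub (PROVABLE; the lead's own) — the critical floor from positive-probability BOUNDEDNESS of the
shell-crosser count**, given the two tools: the proof of `ShellUniq.criticalFloor_of_shellFew27_syndetic`
(p170594) with the 27 grid points replaced by the `N` collinear points `c_i = i⌊n/N!⌋e₀` (`i < N`, inside
`Λ_n` since `N - 1 ≤ N!`), whose pairwise differences `(j-i)⌊n/N!⌋e₀` are bad by `stub_wordToSphere` +
`stub_signedPermChain` + the thick bad sphere `‖·‖∞ ∈ (n - N!, n]` (`bad_pred` iterated `< N!` times);
levels: floor `ρ₀ := p^{N!} τ^{2^{N!+1}} / 2` with `τ := θ^N/(2N²)`; box `K := K₀ + N! + 4`.  Size L. -/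
theorem stub_floorOfShellBounded :
    Sig.stub_wordToSphere → Sig.stub_signedPermChain →
    ∀ N : ℕ, (∃ l : ℕ, 2 ≤ l ∧ ∃ L : ℕ, 1 ≤ L ∧ ∃ δ : ℝ, 0 < δ ∧ ∃ a₀ : ℕ, ∀ a : ℕ, a₀ ≤ a →
        ∃ k : ℕ, a ≤ k ∧ k ≤ L * a ∧
        δ ≤ (bondPercolation (zdGraph 3) (criticalProbI 3)).real {ω : BondConfig (Site 3) |
          ¬ ∃ x : Fin N → Site 3, (∀ i, x i ∈ innerBoundary (zdGraph 3) (box 3 (k + 1))) ∧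
            (∀ i, ∃ b ∈ innerBoundary (zdGraph 3) (box 3 (l * (k + 1))),
              ω ∈ openConnIn (↑(box 3 (l * (k + 1)) \ box 3 k) : Set (Site 3)) (x i) b) ∧
            ∀ i j, i ≠ j → ω ∉ openConnIn (↑(box 3 (l * (k + 1)) \ box 3 k) : Set (Site 3)) (x i) (x j)}) →
      0 < theta (zdGraph 3) (0 : Site 3) (criticalProbI 3) →
      ∃ ρ₀ : ℝ, 0 < ρ₀ ∧ ∃ K : ℕ, 1 ≤ K ∧ ∀ n : ℕ, 1 ≤ n →
        ∃ x ∈ innerBoundary (zdGraph 3) (box 3 n),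
          ρ₀ ≤ (bondPercolation (zdGraph 3) (criticalProbI 3)).real
            (openConnIn (↑(box 3 (K * n)) : Set (Site 3)) (0 : Site 3) x) := by
  sorry

/-- **Stub (OPEN) — NON-PROLIFERATION OF SHELL-CROSSING CLUSTERS AT A PERCOLATING `p_c(ℤ³)`.**  IF
`θ(p_c) > 0`, there are a bound `N`, an aspect ratio `l ≥ 2`, `L ≥ 1`, `δ > 0` and `a₀` such that for every
`a ≥ a₀` some scale `k ∈ [a, La]` is good: with `P_{p_c}`-probability `≥ δ` there are NO `N` sites of the
sphere `∂ⁱⁿΛ_{k+1}`, each joined INSIDE the shell `Λ_{l(k+1)} ∖ Λ_k` to the sphere `∂ⁱⁿΛ_{l(k+1)}`, pairwise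
not joined inside the shell — the open subgraph induced on the shell has fewer than `N` crossing clusters.
Positive-probability TIGHTNESS of the number of spanning clusters of a bounded-aspect shell at a
log-syndetic set of scales: the non-proliferation statement of Aizenman 1997 (Nucl. Phys. B 485, §1: in
`d = 2` the number of spanning clusters is tight with `e^{-αk²}` tails; for `d > 6` they proliferate like
`L^{d-6}`; "it is not clear whether the actual rate is not slower for `d = 3,4,5`") and of BCKS 1999, in the
family of `PercNonProliferation`'s crux 4444 (`∃ M c, ∃ᶠ n, P(≤ M clusters of Λ_{2n} from Λ_n) ≥ c`) and
of its load-bearing stub S1; vacuous if `θ(p_c) = 0`, so a consequence of the summit; numerically the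
count has mean `≈ 17 / 6.3 / 3.7` at aspect `2 / 3 / 4` (j025505).  OPEN — no technology bounds the number
of crossing clusters of a bounded-aspect shell at `p_c(ℤ³)`.  Size: open problem. -/
theorem stub_jumpShellBoundedSyndetic :
    0 < theta (zdGraph 3) (0 : Site 3) (criticalProbI 3) →
    ∃ N : ℕ, ∃ l : ℕ, 2 ≤ l ∧ ∃ L : ℕ, 1 ≤ L ∧ ∃ δ : ℝ, 0 < δ ∧ ∃ a₀ : ℕ, ∀ a : ℕ, a₀ ≤ a →
      ∃ k : ℕ, a ≤ k ∧ k ≤ L * a ∧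
      δ ≤ (bondPercolation (zdGraph 3) (criticalProbI 3)).real {ω : BondConfig (Site 3) |
        ¬ ∃ x : Fin N → Site 3, (∀ i, x i ∈ innerBoundary (zdGraph 3) (box 3 (k + 1))) ∧
          (∀ i, ∃ b ∈ innerBoundary (zdGraph 3) (box 3 (l * (k + 1))),
            ω ∈ openConnIn (↑(box 3 (l * (k + 1)) \ box 3 k) : Set (Site 3)) (x i) b) ∧
          ∀ i j, i ≠ j → ω ∉ openConnIn (↑(box 3 (l * (k + 1)) \ box 3 k) : Set (Site 3)) (x i) (x j)} := by
  sorry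

/-! ## §2 Composition (kernel-checked, no `sorry`): the stubs give the crux by name -/

/-- **The crux from the registered stubs** (reshape 5): under `θ(p_c) > 0` the open stub supplies a bound
`N` and the shell hypothesis; `stub_floorOfShellBounded` (with the two tools) turns it into the critical
one-site floor, and `linearScaleLROOfTheta_of_criticalFloor` (p150787) concludes the crux BY NAME. -/
theorem LinearScaleLROOfTheta_of_stubs (hW : Sig.stub_wordToSphere) (hC : Sig.stub_signedPermChain)
    (hF : Sig.stub_floorOfShellBounded) (hU : Sig.stub_jumpShellBoundedSyndetic) :
    Summit.CriticalPhenomena.PercolationContinuityZ3.Theses.PercFiniteBoxLRO.LinearScaleLROOfTheta :=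
  Summit.CriticalPhenomena.PercolationContinuityZ3.Theorems.linearScaleLROOfTheta_of_criticalFloor
    fun hθ => by
      obtain ⟨N, hN⟩ := hU hθ
      exact hF hW hC N hN hθ

/-! ## §3 Consistency and record -/

/-- The registered stubs, as spelled out, ARE the name-keyed statements. -/
theorem wordToSphere_registered : Sig.stub_wordToSphere := stub_wordToSphere

/-- (idem) -/
theorem signedPermChain_registered : Sig.stub_signedPermChain := stub_signedPermChain

/-- (idem) -/
theorem floorOfShellBounded_registered : Sig.stub_floorOfShellBounded := stub_floorOfShellBounded

/-- (idem) -/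
theorem jumpShellBoundedSyndetic_registered : Sig.stub_jumpShellBoundedSyndetic := stub_jumpShellBoundedSyndetic

/-- The 27-form of reshape 4 is the case `N = 27` of the open stub. -/
theorem jumpShellBoundedSyndetic_of_few27 (h : Sig.stub_jumpShellFew27Syndetic) :
    Sig.stub_jumpShellBoundedSyndetic := fun hθ => ⟨27, h hθ⟩

/-- The θ-free 27-form still gives the crux directly (landed p170594), independently of reshape 5. -/
theorem crux_of_shellFew27Syndetic
    (h : ∃ l : ℕ, 2 ≤ l ∧ ∃ L : ℕ, 1 ≤ L ∧ ∃ δ : ℝ, 0 < δ ∧ ∃ a₀ : ℕ, ∀ a : ℕ, a₀ ≤ a →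
      ∃ k : ℕ, a ≤ k ∧ k ≤ L * a ∧
      δ ≤ (bondPercolation (zdGraph 3) (criticalProbI 3)).real {ω : BondConfig (Site 3) |
        ¬ ∃ x : Fin 27 → Site 3, (∀ i, x i ∈ innerBoundary (zdGraph 3) (box 3 (k + 1))) ∧
          (∀ i, ∃ b ∈ innerBoundary (zdGraph 3) (box 3 (l * (k + 1))),
            ω ∈ openConnIn (↑(box 3 (l * (k + 1)) \ box 3 k) : Set (Site 3)) (x i) b) ∧
          ∀ i j, i ≠ j → ω ∉ openConnIn (↑(box 3 (l * (k + 1)) \ box 3 k) : Set (Site 3)) (x i) (x j)}) :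
    Sig.stub_critBoundaryGluing :=
  Summit.CriticalPhenomena.PercolationContinuityZ3.Theorems.ShellUniq.criticalFloor_of_shellFew27_syndetic h

/-- The crux-equivalent entrance (reshape 2), landed `linearScaleLROOfTheta_iff_criticalFloor`. -/
theorem crux_iff_critBoundaryGluing :
    Summit.CriticalPhenomena.PercolationContinuityZ3.Theses.PercFiniteBoxLRO.LinearScaleLROOfTheta ↔
      Sig.stub_critBoundaryGluing :=
  Summit.CriticalPhenomena.PercolationContinuityZ3.Theorems.linearScaleLROOfTheta_iff_criticalFloor

/- The crux from the registered stubs (an `example`, so no `sorry`-tainted proof of the crux enters the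
environment under a name). -/
example : Summit.CriticalPhenomena.PercolationContinuityZ3.Theses.PercFiniteBoxLRO.LinearScaleLROOfTheta :=
  LinearScaleLROOfTheta_of_stubs wordToSphere_registered signedPermChain_registered
    floorOfShellBounded_registered jumpShellBoundedSyndetic_registered

end Summit.CriticalPhenomena.PercolationContinuityZ3.Cruxes.LinearScaleLROOfTheta.Birth
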